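import Literature.NumberTheory.Automorphic.AsaiSignArchParityTwist
import Literature.NumberTheory.Automorphic.AutomorphicRepsGLSatakeFlathProofs
import HarnessLib

/-!
# Quadratic descent for `GL₂`, line `Sketch` — stub W5: the twisted datum is unitary almost everywhere

Helper file for the crux `ParityBlindBianchi.QuadraticDescentGL2` (stmt-Langlands-16811), line
`Sketch`, stub `stub_unitaryAE`.

Setting: `E/F` quadratic with involution `c`, a cuspidal `P` on `GL₂(𝔸_E)` with Asai datum `(S, A)`,
Hecke characters `χ` of `F` and `μ` of `E`, both unitary, `μ` unramified above the complement of `S`,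
the central clause `e₂(A w) χ(ϖ_v)^{f(w|v)} = 1` above every `v ∉ S`, and a cuspidal `P'` with Asai
datum `(S, μ(ϖ) • A)` (the twist `P ⊗ (μ ∘ det)`). Claim: for all but finitely many finite places `w`
of `E`, every Satake parameter `α` of `P'` at `w` has `|e₂(α)| = 1`.

Proof (norms only, no case split into inert/split places): the places of `E` above `S` form a finite
set (`tendsto_under_cofinite`), so eventually `v = w ∩ 𝓞 F ∉ S`; there `α = μ(ϖ_w) • A w` by the
uniqueness of Satake parameters (`AutomorphicRepData.hasSatakeParamAt_unique_holds`, Flath 1979), so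
`e₂(α) = μ(ϖ_w)^{#A w} e₂(A w)` has absolute value `|e₂(A w)|` (`μ` unitary,
`HeckeCharacter.norm_valueAtUniformizer_of_isUnitary`), and the central clause gives
`|e₂(A w)| |χ(ϖ_v)|^{f} = 1` with `|χ(ϖ_v)| = 1` (`χ` unitary). The hypotheses `[E : F] = 2`, `c ≠ 1`,
`μ|_{𝕀_F} = χ` and the unramifiedness of `μ` are not used.

All inputs are theorems of the tree (`AsaiSign`, `AutomorphicRepsGLSatakeFlathProofs`,
`HeckeCharacterProofs`, `Sweep1Proofs`).
-/

set_option linter.dupNamespace false -- `Summit.Langlands.Langlands` is the mandated namespace (lakefile weak option)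

namespace Summit.Langlands.Langlands.Theorems.QuadraticDescentGL2.Sketch

open scoped Classical
open NumberField IsDedekindDomain Filter
open Literature.NumberTheory.Automorphic Literature.NumberTheory.GaloisRepresentations

/-- **Stub W5 (the twisted datum is unitary almost everywhere).** With `χ`, `μ` unitary, `μ` over `χ`
and unramified above the complement of `S`, and the central clause `e₂(A w) χ(ϖ_v)^{f(w|v)} = 1` above
`v ∉ S`: every Satake parameter of the twist `P'` (Asai datum `(S, μ(ϖ) • A)`) off the finitely many
places above `S` has `|e₂| = 1` — by uniqueness of Satake parameters (`hasSatakeParamAt_unique_holds`)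
`e₂ = μ(ϖ_w)^{2} e₂(A w)`, of absolute value `|e₂(A w)| = |χ(ϖ_v)|^{-f(w|v)} = 1`. [folklore] -/
theorem stub_unitaryAE :
    ∀ (F E : Type) [Field F] [NumberField F] [Field E] [NumberField E] [Algebra F E] (c : E ≃ₐ[F] E),
      Module.finrank F E = 2 → c ≠ 1 →
      ∀ (hE : isCompact_glFiniteIntegralLevel 2 E) (P P' : CuspidalAutomorphicRepData 2 E hE)
        (μ : HeckeCharacter E) (χ : HeckeCharacter F) (S : Set (HeightOneSpectrum (𝓞 F))) (A : SatakeFamily E),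
        P.1.IsAsaiDatum c S A → χ.IsUnitary →
        (∀ x, μ (AdeleRing.ideleBaseChange F E x) = χ x) → μ.IsUnitary →
        (∀ w : HeightOneSpectrum (𝓞 E), w.under (𝓞 F) ∉ S → μ.IsUnramifiedAt w) →
        (∀ w : HeightOneSpectrum (𝓞 E), w.under (𝓞 F) ∉ S →
          (A w).prod * χ.valueAtUniformizer (w.under (𝓞 F)) ^ w.asIdeal.inertiaDeg (𝓞 F) = 1) →
        P'.1.IsAsaiDatum c S (fun w => (A w).map (μ.valueAtUniformizer w * ·)) →
        ∀ᶠ w : HeightOneSpectrum (𝓞 E) in cofinite, ∀ α : Multiset ℂ,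
          P'.1.HasSatakeParamAt w α → ‖α.prod‖ = 1 := by
  intro F E _ _ _ _ _ c _h2 _hc hE P P' μ χ S A hSA hχu _hres hμu _hunr hcent hSA'
  -- eventually `w ∩ 𝓞 F ∉ S`
  have hSE : ∀ᶠ w : HeightOneSpectrum (𝓞 E) in cofinite, w.under (𝓞 F) ∉ S :=
    (tendsto_under_cofinite (𝓞 F)).eventually hSA.finite.compl_mem_cofinite
  filter_upwards [hSE] with w hw α hα
  -- `α = μ(ϖ_w) • A w` by uniqueness of Satake parameters
  have hαeq : α = (A w).map (μ.valueAtUniformizer w * ·) :=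
    P'.1.hasSatakeParamAt_unique_holds hα (hSA'.hasSatakeParamAt hw)
  have hprod : α.prod = μ.valueAtUniformizer w ^ Multiset.card (A w) * (A w).prod := by
    rw [hαeq, Multiset.prod_map_mul, Multiset.map_const', Multiset.prod_replicate, Multiset.map_id']
  -- the central clause in norms: `‖e₂(A w)‖ = 1`
  have hn := congrArg (fun z : ℂ => ‖z‖) (hcent w hw)
  simp only [norm_mul, norm_pow, HeckeCharacter.norm_valueAtUniformizer_of_isUnitary hχu, one_pow,
    mul_one, norm_one] at hn
  rw [hprod, norm_mul, norm_pow, HeckeCharacter.norm_valueAtUniformizer_of_isUnitary hμu, one_pow,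
    one_mul, hn]

end Summit.Langlands.Langlands.Theorems.QuadraticDescentGL2.Sketch
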